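import Mathlib
import HarnessLib
import Summits.SmoothPoincare4.SmoothPoincare4.Theses.SmoothBijectionDefect
import Literature.Topology.FourManifolds.HomotopyS4OrientableProofs

/-!
# Line `birth` — BC3 skeleton for the crux `ShRigid` (stmt-SmoothPoincare4-13496)

Route `SmoothBijectionDefect` (route-SmoothPoincare4-SmoothBijectionDefect), crux #3 `ShRigid`
(SH-RIGIDITY MODULO UNITS, card K2 (β)):

  `∀ Σ : HomotopySphere 4, (∃ smooth bijection f : S⁴ → Σ) ∨ (∃ smooth bijection g : Σ → S⁴) →
     ∀ p, Σ ∖ {p} embeds smoothly in ℝ⁴`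

(a homotopy 4-sphere comparable with the round sphere by a `C^∞` bijection in either direction is a
unit of the connected-sum monoid, in Gabai's punctured-embedding form). This file is the route-level
BIRTH CERTIFICATE skeleton of the crux (LENSES-v3 §2 BC3; registrar seat
`planner-skel-stmt-SmoothPoincare4-13496-0`, 2026-08-17; the crux had no workfiles, no `Disproof.lean`,
no registered line before it). It records the REGULAR-POINT LOCALISATION of the crux as four NAMED
PIECES — two true plumbing lemmas and the two open cores, one per direction of comparison — with a
sorry-free composition and a sorry-free converse, so that the line is an EXACT split:

* `stub_regularPoint` (R, TRUE, M–L) — a `C^∞` injection between smooth 4-manifolds has a point where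
  it is a local diffeomorphism (rank semicontinuity + constant rank, or Sard). This is what makes the
  defect `{df singular}` of a smooth bijection `S⁴ ⇄ Σ` miss a point, hence — after puncturing there —
  COMPACT inside `ℝ⁴ ≅ S⁴ ∖ {x₀}`.
* `stub_homogeneity` (H, TRUE, M–L) — on a connected smooth 4-manifold, if `M ∖ {q}` embeds in `ℝ⁴`
  for one `q` then `M ∖ {p}` does for every `p` (Milnor's homogeneity lemma + transport of a smooth
  embedding along the restricted diffeomorphism; `Diffeomorph.isSmoothEmbedding` and
  `IsSmoothEmbedding.comp` are still `proof_wanted` in Mathlib).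
* `stub_rigidFrom` (F, OPEN — the `S⁴ → Σ` half in local form) — a smooth bijection `f : S⁴ → N`
  onto a closed smooth 4-manifold, local diffeomorphism at `x₀` ⟹ `N ∖ {f x₀} ↪ ℝ⁴`. Read through
  the stereographic chart at `x₀`: an open 4-manifold `V` receiving a smooth bijection `F : ℝ⁴ → V`
  with COMPACT defect embeds in `ℝ⁴`; in ball form (the route header's foreseen `ShRigidBall`): a
  compact contractible `Q⁴`, `∂Q ≅ S³`, receiving a collared smooth bijection from `B⁴` embeds in `ℝ⁴`.
* `stub_rigidTo` (T, OPEN — the `Σ → S⁴` half in local form) — a smooth bijection `g : M → S⁴` from a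
  closed smooth 4-manifold, local diffeomorphism at `y₀` ⟹ `M ∖ {y₀} ↪ ℝ⁴`; i.e. an open 4-manifold
  mapping smoothly and bijectively ONTO `ℝ⁴` with compact defect embeds in (equivalently, having the
  standard end, is) `ℝ⁴`.
* `shRigid_of_stubSigs : R-sig → H-sig → F-sig → T-sig → (body of ShRigid)` — SORRY-FREE (axioms
  propext / Classical.choice / Quot.sound, checked): case on the direction; R supplies a regular point
  (nonemptiness from the point `p` in hand), F or T embeds the puncture at (the image of) the regular
  point, H moves the puncture to `p`; connectedness of `Σ` for H is proved here
  (`connectedSpace_carrier`: `S⁴` is path connected and path-connectedness is a homotopy invariant).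
* `ShRigid_of : ShRigid` — THE skeleton theorem: the crux BY NAME from the four declared stubs (the
  file's only theorem whose head is the crux; `sorry` occurs ONLY in the four `stub_*` bodies).
* `stubFrom_of_shRigid`, `stubTo_of_shRigid`, `shRigid_iff_stubs` — SORRY-FREE EXACTNESS: the crux
  implies F and T (a closed 4-manifold continuously bijecting with `S⁴` is homeomorphic, hence homotopy
  equivalent, to it, and orientable by `isOrientable_of_homotopyEquiv_sphere_four_holds`, Lee Thm.
  15.43, so it packages as a `HomotopySphere 4`), hence `R → H → (ShRigid ↔ F ∧ T)`. Neither open stub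
  is stronger than the crux; each is refutable only by a fake 4-sphere comparable with `S⁴` in its
  direction (the crux's own risk, route item why-might-fail).

Why this cut (and not finer). The crux's difficulty is entirely in F and T; the skeleton does not
pretend otherwise (BC3 asks for named pieces and a kernel-checked composition, not for progress). What
the cut BUYS is the legitimate passage from the global statement on `Σ` to the LOCAL one a prover will
actually attack — a smooth bijection of `ℝ⁴` with a degenerate locus of compact support (source side:
the degenerate pulled-back metric `F*g_Σ` on `ℝ⁴`, flat outside a compact set, the object of the card's
Cheeger–Colding lever; target side: the semi-definite tensor `g*h_round` on `V`) — with the two facts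
that make the passage honest (R: the defect misses a point; H: the puncture is immaterial) split off
as separately provable obligations instead of being waved through. The finer ball form `ShRigidBall`
+ `UnitOfBall` of the route header is one glued split below F (layer 2), to be filed by the lead /
tenure planner when F is attacked; it needs manifolds-with-boundary plumbing
(`BoundaryData`, collars) that would only add bookkeeping stubs here.

## Disproof used

None exists: `Cruxes/ShRigid/` had no `Disproof.lean`, no `Negative/` lemma and no dead line at
registration (`ledger crux ls stmt-SmoothPoincare4-13496`: no workfiles; `ledger negatives --problem
SmoothPoincare4`: 0 refuted statements, 2026-08-17). The refuter's crux-attack (item notes, 2026-08-15)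
records only the restatement facts `SchsplitPuncturedEmbeds → ShRigid` (hypothesis unused) and
`ThinDefect → ShRigid → SchsplitPuncturedEmbeds`; no stub here is an instance of either.

## BC3 probes (registrar, 2026-08-17; files `bc/probe_*.lean` of the registrar's folder)

For each stub `X ∈ {R, H, F, T}` (its statement pasted as a closed `def StubSig : Prop`; imports
`Mathlib` + the route file only): `example : StubSig → ShRigid` and `example : StubSig →
_root_.SmoothPoincare4` by `first | exact? | simpa [StubSig] | (unfold StubSig; simpa) | aesop` under
`set_option maxHeartbeats 400000` — ALL 8 FAIL: R→crux, R→summit, H→crux, H→summit: rc 1 "unsolved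
goals" after `aesop: failed to prove the goal after exhaustive search` (so `exact?` and both `simpa`s
failed normally before it); F→crux, F→summit, T→crux, T→summit: rc 1 deterministic timeout at 400 000
heartbeats inside the `simpa` alternative — therefore each alternative was ALSO run alone for F and T
(16 files): `exact?` "could not close the goal" (4/4), `aesop` "failed to prove the goal after
exhaustive search" (4/4), `simpa [StubSig]` and `unfold StubSig; simpa` time out at 400 000 heartbeats
(8/8). No stub is cheaply the crux or the summit: R and H are true lemmas of differential topology,
F and T are one direction each and need R and H to reach the crux. Converse direction recorded above
(`crux → F`, `crux → T` PROVED; `crux → R`, `crux → H` not expected — R, H are unconditional facts).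

## References

* D. Gabai, *3-spheres in the 4-sphere and pseudo-isotopies of S¹ × S³*, arXiv:2212.02004, Def. 1.3,
  Prop. 1.9 (units of the homotopy-4-sphere monoid = Schoenflies balls; `Σ` unit ⇔ `Σ ∖ pt ≅ ℝ⁴`).
* J. Milnor, *Topology from the Differentiable Viewpoint* (1965), §4, Homogeneity Lemma; §2–3 (Sard,
  regular values).
* J. M. Lee, *Introduction to Smooth Manifolds*, 2nd ed. (2013), Thm. 4.12 (constant rank), Thm. 15.43.
* J. Cheeger, T. Colding, *On the structure of spaces with Ricci curvature bounded below I*, JDG 46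
  (1997) (the card's lever for F; not used formally here).
* M. Freedman, F. Quinn, *Topology of 4-manifolds* (1990), 8.1A (defects of homeomorphisms are fat).
-/

set_option linter.dupNamespace false
set_option linter.unusedVariables false

noncomputable section

namespace Summit.SmoothPoincare4.SmoothPoincare4.Cruxes.ShRigid.Birth

open scoped Manifold ContDiff Topology
open Literature.Topology.FourManifolds
open Summit.SmoothPoincare4.SmoothPoincare4.Theses.SmoothBijectionDefect

/-- Local notation: the model space `ℝ⁴ = EuclideanSpace ℝ (Fin 4)`. -/
local notation "ℝ⁴" => EuclideanSpace ℝ (Fin 4)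

/-- Local notation: the round 4-sphere `S⁴ ⊂ ℝ⁵` with Mathlib's stereographic atlas. -/
local notation "𝕊⁴" => (Metric.sphere (0 : EuclideanSpace ℝ (Fin 5)) 1)

/-! ## The registered stubs -/

/-- **Stub R `stub_regularPoint` — smooth injections between 4-manifolds have a regular point.**
A `C^∞` injection `f : M → N` between smooth 4-manifolds (Hausdorff, second countable), `M`
nonempty, is a local diffeomorphism at some point. (Rank argument: the rank of `df` is lower
semicontinuous, hence locally constant on an open dense set; by the constant-rank theorem an
injective map cannot have locally constant rank `< 4`; so `df` is invertible somewhere — indeed on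
an open dense set — and the inverse function theorem applies. Alternatively Sard: critical values
are null, so a bijection has a regular value with its unique preimage regular.) TRUE; size M–L in
Mathlib (inverse function theorem on manifolds / constant rank are not yet packaged as
`IsLocalDiffeomorphAt`). [folklore] -/
theorem stub_regularPoint :
    ∀ (M N : Type) [TopologicalSpace M] [T2Space M] [SecondCountableTopology M]
      [ChartedSpace ℝ⁴ M] [IsManifold (𝓡 4) ∞ M]
      [TopologicalSpace N] [T2Space N] [SecondCountableTopology N]
      [ChartedSpace ℝ⁴ N] [IsManifold (𝓡 4) ∞ N]
      (f : M → N), ContMDiff (𝓡 4) (𝓡 4) ∞ f → Function.Injective f → Nonempty M →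
        ∃ x : M, IsLocalDiffeomorphAt (𝓡 4) (𝓡 4) ∞ f x := by
  sorry

/-- **Stub H `stub_homogeneity` — punctured embeddability does not depend on the puncture.**
On a connected smooth 4-manifold `M` (Hausdorff, second countable): if `M ∖ {q}` embeds smoothly
in `ℝ⁴` for one point `q`, then `M ∖ {p}` does for every point `p`. (Homogeneity lemma: the
diffeomorphism group of a connected manifold acts transitively — Milnor, *Topology from the
differentiable viewpoint*, §4 — and a smooth embedding precomposed with the restriction of a
diffeomorphism `φ`, `φ p = q`, to the open submanifold `{p}ᶜ → {q}ᶜ` is a smooth embedding.)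
TRUE; size M–L (transitivity of `Diff(M)` via compactly supported flows, plus
`Diffeomorph.isSmoothEmbedding` / `IsSmoothEmbedding.comp`, both still `proof_wanted` in Mathlib).
[cite: MilnorTDV1965, §4 Homogeneity Lemma] -/
theorem stub_homogeneity :
    ∀ (M : Type) [TopologicalSpace M] [T2Space M] [SecondCountableTopology M]
      [ChartedSpace ℝ⁴ M] [IsManifold (𝓡 4) ∞ M] [ConnectedSpace M] (p q : M),
      (∃ e : (⟨{q}ᶜ, isOpen_compl_singleton⟩ : TopologicalSpace.Opens M) → ℝ⁴,
          Manifold.IsSmoothEmbedding (𝓡 4) (𝓡 4) ∞ e) →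
        ∃ e : (⟨{p}ᶜ, isOpen_compl_singleton⟩ : TopologicalSpace.Opens M) → ℝ⁴,
          Manifold.IsSmoothEmbedding (𝓡 4) (𝓡 4) ∞ e := by
  sorry

/-- **Stub F `stub_rigidFrom` — THE OPEN CORE, source side (compact-defect rigidity of `ℝ⁴`,
pushed forward).** If `f : S⁴ → N` is a smooth bijection onto a smooth 4-manifold `N` and `f` is
a local diffeomorphism at `x₀`, then `N ∖ {f x₀}` embeds smoothly in `ℝ⁴`. Equivalently (via
stereographic projection from `x₀`, under which `f` becomes a smooth bijection
`F : ℝ⁴ → V := N ∖ {f x₀}` whose defect `{dF singular}` is COMPACT, `F` being a diffeomorphism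
near `x₀`, i.e. near infinity): an open 4-manifold that receives a smooth bijection from `ℝ⁴`
with compact defect embeds in `ℝ⁴`; in ball form (the route's `ShRigidBall`): a compact
contractible smooth `Q` with `∂Q ≅ S³` receiving a collared smooth bijection from `B⁴` embeds in
`ℝ⁴`. OPEN (it is the `S⁴ → Σ` half of the crux in local form; false iff some NON-unit homotopy
4-sphere receives a smooth bijection from `S⁴`). Lever on record (card K2): the degenerate tensor
`F*g` has no Ricci-bounded-below, volume-non-collapsing smoothings from above unless `V ≅ ℝ⁴`
(Cheeger–Colding volume rigidity). OPEN route obligation, not a cited result; sources: arXiv:2212.02004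
(Def. 1.3, Prop. 1.9: units), CheegerColding1997 (lever), FreedmanQuinn1990 8.1A (contrast). -/
theorem stub_rigidFrom :
    ∀ (N : Type) [TopologicalSpace N] [T2Space N] [SecondCountableTopology N]
      [ChartedSpace ℝ⁴ N] [IsManifold (𝓡 4) ∞ N] [CompactSpace N]
      (f : 𝕊⁴ → N) (x₀ : 𝕊⁴), ContMDiff (𝓡 4) (𝓡 4) ∞ f → Function.Bijective f →
        IsLocalDiffeomorphAt (𝓡 4) (𝓡 4) ∞ f x₀ →
          ∃ e : (⟨{f x₀}ᶜ, isOpen_compl_singleton⟩ : TopologicalSpace.Opens N) → ℝ⁴,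
            Manifold.IsSmoothEmbedding (𝓡 4) (𝓡 4) ∞ e := by
  sorry

/-- **Stub T `stub_rigidTo` — THE OPEN CORE, target side (compact-defect rigidity of `ℝ⁴`,
pulled back).** If `g : M → S⁴` is a smooth bijection from a closed smooth 4-manifold `M` and `g`
is a local diffeomorphism at `y₀`, then `M ∖ {y₀}` embeds smoothly in `ℝ⁴`. Equivalently
(stereographic projection from `g y₀`): an open 4-manifold `V` admitting a smooth bijection ONTO
`ℝ⁴` with compact defect embeds in `ℝ⁴` (`V` is then homeomorphic to `ℝ⁴` with a standard smooth
end `S³ × [0, ∞)`, so the claim is `V ≅ ℝ⁴`: no small-exotic-`ℝ⁴`-with-standard-end, i.e. no fake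
punctured unit... of this comparable kind). OPEN (the `Σ → S⁴` half of the crux in local form;
false iff some non-unit homotopy 4-sphere maps smoothly and bijectively onto `S⁴`). Here the
degenerate object is the pulled-back round metric `g*h` on `V`, positive semidefinite, degenerate
exactly on the compact defect. OPEN route obligation, not a cited result; sources: arXiv:2212.02004
(Def. 1.3, Prop. 1.9: units), FreedmanQuinn1990 8.1A (contrast). -/
theorem stub_rigidTo :
    ∀ (M : Type) [TopologicalSpace M] [T2Space M] [SecondCountableTopology M]
      [ChartedSpace ℝ⁴ M] [IsManifold (𝓡 4) ∞ M] [CompactSpace M]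
      (g : M → 𝕊⁴) (y₀ : M), ContMDiff (𝓡 4) (𝓡 4) ∞ g → Function.Bijective g →
        IsLocalDiffeomorphAt (𝓡 4) (𝓡 4) ∞ g y₀ →
          ∃ e : (⟨{y₀}ᶜ, isOpen_compl_singleton⟩ : TopologicalSpace.Opens M) → ℝ⁴,
            Manifold.IsSmoothEmbedding (𝓡 4) (𝓡 4) ∞ e := by
  sorry

/-! ## Sorry-free glue -/

/-- A space homotopy equivalent to a path-connected space is path connected (inlined from
`Literature.AlgebraicTopology.Homotopy.pathConnectedSpace_of_homotopyEquiv` to keep the imports of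
this workfile minimal). [folklore] -/
theorem pathConnectedSpace_of_homotopyEquiv' {X Y : Type*} [TopologicalSpace X]
    [TopologicalSpace Y] [PathConnectedSpace X] (e : ContinuousMap.HomotopyEquiv X Y) :
    PathConnectedSpace Y := by
  have key : ∀ y : Y, Joined (e.toFun (e.invFun y)) y := fun y =>
    ⟨e.right_inv.some.evalAt y⟩
  refine ⟨⟨e.toFun (Classical.arbitrary X)⟩, fun y y' => ?_⟩
  have hmid : Joined (e.toFun (e.invFun y)) (e.toFun (e.invFun y')) :=
    ⟨(PathConnectedSpace.somePath (e.invFun y) (e.invFun y')).map e.toFun.continuous⟩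
  exact ((key y).symm.trans hmid).trans (key y')

/-- The round 4-sphere is path connected. [folklore] -/
theorem pathConnectedSpace_sphereFour : PathConnectedSpace 𝕊⁴ := by
  rw [← isPathConnected_iff_pathConnectedSpace]
  refine isPathConnected_sphere ?_ 0 zero_le_one
  rw [← Module.finrank_eq_rank, finrank_euclideanSpace_fin]
  norm_num

/-- The carrier of a homotopy 4-sphere is connected (it is homotopy equivalent to the
path-connected `S⁴`). [folklore] -/
theorem connectedSpace_carrier (S : HomotopySphere 4) : ConnectedSpace S.carrier := by
  haveI : PathConnectedSpace 𝕊⁴ := pathConnectedSpace_sphereFour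
  haveI : PathConnectedSpace S.carrier :=
    pathConnectedSpace_of_homotopyEquiv' S.nonempty_homotopyEquiv.some.symm
  infer_instance

/-- **Composition with explicit hypotheses** (BC3 shape `stub_R-sig → stub_H-sig → stub_F-sig →
stub_T-sig → crux`; the conclusion is the one-step unfolding of `ShRigid`, so that `ShRigid_of`
below is the only theorem of the file whose head is the crux name). Sorry-free logic: given `Σ`,
a comparison map and a point `p` — if `f : S⁴ → Σ`, R gives a regular point `x₀` (the sphere is
nonempty because `f` hits `p`), F embeds `Σ ∖ {f x₀}`, H moves the puncture to `p`; if
`g : Σ → S⁴`, R gives a regular point `y₀ ∈ Σ`, T embeds `Σ ∖ {y₀}`, H moves the puncture.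
Connectedness of `Σ` (needed by H) is `connectedSpace_carrier`. [folklore] -/
theorem shRigid_of_stubSigs
    (hR : ∀ (M N : Type) [TopologicalSpace M] [T2Space M] [SecondCountableTopology M]
      [ChartedSpace ℝ⁴ M] [IsManifold (𝓡 4) ∞ M]
      [TopologicalSpace N] [T2Space N] [SecondCountableTopology N]
      [ChartedSpace ℝ⁴ N] [IsManifold (𝓡 4) ∞ N]
      (f : M → N), ContMDiff (𝓡 4) (𝓡 4) ∞ f → Function.Injective f → Nonempty M →
        ∃ x : M, IsLocalDiffeomorphAt (𝓡 4) (𝓡 4) ∞ f x)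
    (hH : ∀ (M : Type) [TopologicalSpace M] [T2Space M] [SecondCountableTopology M]
      [ChartedSpace ℝ⁴ M] [IsManifold (𝓡 4) ∞ M] [ConnectedSpace M] (p q : M),
      (∃ e : (⟨{q}ᶜ, isOpen_compl_singleton⟩ : TopologicalSpace.Opens M) → ℝ⁴,
          Manifold.IsSmoothEmbedding (𝓡 4) (𝓡 4) ∞ e) →
        ∃ e : (⟨{p}ᶜ, isOpen_compl_singleton⟩ : TopologicalSpace.Opens M) → ℝ⁴,
          Manifold.IsSmoothEmbedding (𝓡 4) (𝓡 4) ∞ e)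
    (hF : ∀ (N : Type) [TopologicalSpace N] [T2Space N] [SecondCountableTopology N]
      [ChartedSpace ℝ⁴ N] [IsManifold (𝓡 4) ∞ N] [CompactSpace N]
      (f : 𝕊⁴ → N) (x₀ : 𝕊⁴), ContMDiff (𝓡 4) (𝓡 4) ∞ f → Function.Bijective f →
        IsLocalDiffeomorphAt (𝓡 4) (𝓡 4) ∞ f x₀ →
          ∃ e : (⟨{f x₀}ᶜ, isOpen_compl_singleton⟩ : TopologicalSpace.Opens N) → ℝ⁴,
            Manifold.IsSmoothEmbedding (𝓡 4) (𝓡 4) ∞ e)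
    (hT : ∀ (M : Type) [TopologicalSpace M] [T2Space M] [SecondCountableTopology M]
      [ChartedSpace ℝ⁴ M] [IsManifold (𝓡 4) ∞ M] [CompactSpace M]
      (g : M → 𝕊⁴) (y₀ : M), ContMDiff (𝓡 4) (𝓡 4) ∞ g → Function.Bijective g →
        IsLocalDiffeomorphAt (𝓡 4) (𝓡 4) ∞ g y₀ →
          ∃ e : (⟨{y₀}ᶜ, isOpen_compl_singleton⟩ : TopologicalSpace.Opens M) → ℝ⁴,
            Manifold.IsSmoothEmbedding (𝓡 4) (𝓡 4) ∞ e) :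
    ∀ S : HomotopySphere 4,
      ((∃ f : 𝕊⁴ → S.carrier, ContMDiff (𝓡 4) (𝓡 4) ∞ f ∧ Function.Bijective f) ∨
        (∃ g : S.carrier → 𝕊⁴, ContMDiff (𝓡 4) (𝓡 4) ∞ g ∧ Function.Bijective g)) →
      ∀ p : S.carrier, ∃ e : (⟨{p}ᶜ, isOpen_compl_singleton⟩ : TopologicalSpace.Opens S.carrier) → ℝ⁴,
        Manifold.IsSmoothEmbedding (𝓡 4) (𝓡 4) ∞ e := by
  intro S hS p
  haveI : ConnectedSpace S.carrier := connectedSpace_carrier S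
  rcases hS with ⟨f, hf, hbij⟩ | ⟨g, hg, hbij⟩
  · obtain ⟨x₁, hx₁⟩ := hbij.surjective p
    obtain ⟨x₀, hx₀⟩ := hR _ _ f hf hbij.injective ⟨x₁⟩
    exact hH S.carrier p (f x₀) (hF S.carrier f x₀ hf hbij hx₀)
  · obtain ⟨y₀, hy₀⟩ := hR _ _ g hg hbij.injective ⟨p⟩
    exact hH S.carrier p y₀ (hT S.carrier g y₀ hg hbij hy₀)

/-! ## Exactness: the two open stubs are consequences of the crux (sorry-free converse probes) -/

/-- **Converse, source side.** The crux `ShRigid` implies the statement of `stub_rigidFrom`: a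
compact smooth 4-manifold `N` receiving a smooth bijection `f` from `S⁴` is homeomorphic to `S⁴`
along `f` (continuous bijection, compact → Hausdorff), hence homotopy equivalent to it, hence
orientable (`isOrientable_of_homotopyEquiv_sphere_four_holds`, Lee Thm. 15.43), so it packages as a
`HomotopySphere 4` to which the crux applies with the comparison map `f` itself. So stub F is not
STRONGER than the crux: it is exactly its `S⁴ → Σ` half (given R and H). [folklore] -/
theorem stubFrom_of_shRigid (h : ShRigid) :
    ∀ (N : Type) [TopologicalSpace N] [T2Space N] [SecondCountableTopology N]
      [ChartedSpace ℝ⁴ N] [IsManifold (𝓡 4) ∞ N] [CompactSpace N]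
      (f : 𝕊⁴ → N) (x₀ : 𝕊⁴), ContMDiff (𝓡 4) (𝓡 4) ∞ f → Function.Bijective f →
        IsLocalDiffeomorphAt (𝓡 4) (𝓡 4) ∞ f x₀ →
          ∃ e : (⟨{f x₀}ᶜ, isOpen_compl_singleton⟩ : TopologicalSpace.Opens N) → ℝ⁴,
            Manifold.IsSmoothEmbedding (𝓡 4) (𝓡 4) ∞ e := by
  intro N _ _ _ _ _ _ f x₀ hf hbij _
  have hcont : Continuous (Equiv.ofBijective f hbij) := hf.continuous
  let φ : 𝕊⁴ ≃ₜ N := hcont.homeoOfEquivCompactToT2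
  let e : ContinuousMap.HomotopyEquiv N 𝕊⁴ := φ.symm.toHomotopyEquiv
  obtain ⟨o⟩ := isOrientable_of_homotopyEquiv_sphere_four_holds N e
  exact h ⟨N, o, ⟨e⟩⟩ (Or.inl ⟨f, hf, hbij⟩) (f x₀)

/-- **Converse, target side.** The crux `ShRigid` implies the statement of `stub_rigidTo`
(same packaging, with the homeomorphism `g : M ≃ₜ S⁴`). So stub T is exactly the `Σ → S⁴` half
of the crux (given R and H). [folklore] -/
theorem stubTo_of_shRigid (h : ShRigid) :
    ∀ (M : Type) [TopologicalSpace M] [T2Space M] [SecondCountableTopology M]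
      [ChartedSpace ℝ⁴ M] [IsManifold (𝓡 4) ∞ M] [CompactSpace M]
      (g : M → 𝕊⁴) (y₀ : M), ContMDiff (𝓡 4) (𝓡 4) ∞ g → Function.Bijective g →
        IsLocalDiffeomorphAt (𝓡 4) (𝓡 4) ∞ g y₀ →
          ∃ e : (⟨{y₀}ᶜ, isOpen_compl_singleton⟩ : TopologicalSpace.Opens M) → ℝ⁴,
            Manifold.IsSmoothEmbedding (𝓡 4) (𝓡 4) ∞ e := by
  intro M _ _ _ _ _ _ g y₀ hg hbij _
  have hcont : Continuous (Equiv.ofBijective g hbij) := hg.continuous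
  let ψ : M ≃ₜ 𝕊⁴ := hcont.homeoOfEquivCompactToT2
  let e : ContinuousMap.HomotopyEquiv M 𝕊⁴ := ψ.toHomotopyEquiv
  obtain ⟨o⟩ := isOrientable_of_homotopyEquiv_sphere_four_holds M e
  exact h ⟨M, o, ⟨e⟩⟩ (Or.inr ⟨g, hg, hbij⟩) y₀

/-- **Exactness of the split.** Given the two TRUE plumbing stubs R (regular point) and H
(homogeneity) as hypotheses, the crux is EQUIVALENT to the conjunction of the two open stubs
F ∧ T: `←` is `shRigid_of_stubSigs`, `→` is `stubFrom_of_shRigid` / `stubTo_of_shRigid`. No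
strength is lost or added by the line; the converse BC3 probes `crux → stub` succeed BY THESE
NAMED THEOREMS (as they should for an exact split), while no stub alone gives the crux or the
summit cheaply (registrar's probes, module docstring). [folklore] -/
theorem shRigid_iff_stubs
    (hR : ∀ (M N : Type) [TopologicalSpace M] [T2Space M] [SecondCountableTopology M]
      [ChartedSpace ℝ⁴ M] [IsManifold (𝓡 4) ∞ M]
      [TopologicalSpace N] [T2Space N] [SecondCountableTopology N]
      [ChartedSpace ℝ⁴ N] [IsManifold (𝓡 4) ∞ N]
      (f : M → N), ContMDiff (𝓡 4) (𝓡 4) ∞ f → Function.Injective f → Nonempty M →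
        ∃ x : M, IsLocalDiffeomorphAt (𝓡 4) (𝓡 4) ∞ f x)
    (hH : ∀ (M : Type) [TopologicalSpace M] [T2Space M] [SecondCountableTopology M]
      [ChartedSpace ℝ⁴ M] [IsManifold (𝓡 4) ∞ M] [ConnectedSpace M] (p q : M),
      (∃ e : (⟨{q}ᶜ, isOpen_compl_singleton⟩ : TopologicalSpace.Opens M) → ℝ⁴,
          Manifold.IsSmoothEmbedding (𝓡 4) (𝓡 4) ∞ e) →
        ∃ e : (⟨{p}ᶜ, isOpen_compl_singleton⟩ : TopologicalSpace.Opens M) → ℝ⁴,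
          Manifold.IsSmoothEmbedding (𝓡 4) (𝓡 4) ∞ e) :
    ShRigid ↔
      ((∀ (N : Type) [TopologicalSpace N] [T2Space N] [SecondCountableTopology N]
          [ChartedSpace ℝ⁴ N] [IsManifold (𝓡 4) ∞ N] [CompactSpace N]
          (f : 𝕊⁴ → N) (x₀ : 𝕊⁴), ContMDiff (𝓡 4) (𝓡 4) ∞ f → Function.Bijective f →
            IsLocalDiffeomorphAt (𝓡 4) (𝓡 4) ∞ f x₀ →
              ∃ e : (⟨{f x₀}ᶜ, isOpen_compl_singleton⟩ : TopologicalSpace.Opens N) → ℝ⁴,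
                Manifold.IsSmoothEmbedding (𝓡 4) (𝓡 4) ∞ e) ∧
        (∀ (M : Type) [TopologicalSpace M] [T2Space M] [SecondCountableTopology M]
          [ChartedSpace ℝ⁴ M] [IsManifold (𝓡 4) ∞ M] [CompactSpace M]
          (g : M → 𝕊⁴) (y₀ : M), ContMDiff (𝓡 4) (𝓡 4) ∞ g → Function.Bijective g →
            IsLocalDiffeomorphAt (𝓡 4) (𝓡 4) ∞ g y₀ →
              ∃ e : (⟨{y₀}ᶜ, isOpen_compl_singleton⟩ : TopologicalSpace.Opens M) → ℝ⁴,
                Manifold.IsSmoothEmbedding (𝓡 4) (𝓡 4) ∞ e)) :=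
  ⟨fun h => ⟨stubFrom_of_shRigid h, stubTo_of_shRigid h⟩,
    fun h => shRigid_of_stubSigs hR hH h.1 h.2⟩

/-! ## The skeleton theorem -/

/-- **THE SKELETON THEOREM.** The crux
`Summit.SmoothPoincare4.SmoothPoincare4.Theses.SmoothBijectionDefect.ShRigid`, concluded BY NAME
from the four declared stubs through the sorry-free composition `shRigid_of_stubSigs`; the only
`sorry`s of the file are the four `stub_*` bodies. [folklore] -/
theorem ShRigid_of : ShRigid :=
  shRigid_of_stubSigs stub_regularPoint stub_homogeneity stub_rigidFrom stub_rigidTo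

end Summit.SmoothPoincare4.SmoothPoincare4.Cruxes.ShRigid.Birth

end
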